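import Literature.NumberTheory.NumberFields.CubicFieldResiduePrimes
import HarnessLib

/-!
# Powers of degree-one primes as kernels of maps `𝓞 K → ℤ/pᵏ`; certified ideal factorisations

Generic companions of `CubicFieldResiduePrimes.lean` (degree-one primes of a number field `K` as kernels
of ring homomorphisms `𝓞 K → ℤ/p`), giving the two tools by which explicit descents CERTIFY valuations and
factorisations of explicit algebraic integers (the certificates are congruences and one norm computation):

* `ker_zmodPow_eq_pow` — for ANY ring homomorphism `ψ : 𝓞 K → ℤ/pᵏ` (`p` prime, `k ≥ 1`):
  **`ker ψ = 𝔭ᵏ`** where `𝔭 = ker(ψ mod p)` is the degree-one prime under it. (`𝔭ᵏ ⊆ ker ψ` because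
  `ψ(𝔭) ⊆ p ℤ/pᵏ`; both ideals have norm `pᵏ`.) Hence `x ∈ 𝔭ᵏ ⟺ ψ(x) = 0` (`mem_pow_iff_zmodPow_eq_zero`):
  membership in a prime POWER is a congruence modulo `pᵏ` (Marcus, Ch. 3, Thm. 27 read at level `pᵏ`:
  `𝓞 K/𝔭ᵏ ≅ ℤ/pᵏ` for `𝔭` unramified of degree one).
* `eq_of_le_of_absNorm_eq'`, `eq_mul_of_le_of_le_of_isCoprime` — **certified factorisation**: an ideal contained
  in two coprime ideals whose norms multiply to its norm is their product; with `absNorm_span_singleton`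
  this turns "`x ∈ 𝔭ᵏ`, `x ∈ 𝔮`, `|N(x)| = pᵏ q`" into `(x) = 𝔭ᵏ 𝔮` (`span_singleton_eq_mul_of_mem_of_mem`);
  `isCoprime_of_isMaximal_ne`, `isCoprime_pow_of_isMaximal_ne` supply the coprimality of distinct maximal
  ideals and their powers.

All for an arbitrary number field `K`; theorems only. (The field-specific instances — the class-group witnesses
`(x) = 𝔭 · 𝔭₂ᵏ` of the `2`-division field of `E_{28/9}` — are in the sequel.) The concrete-field versions of the
factorisation certificates exist in the tree for `CyclicCubicField1339A` (there tied to that field's definition).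

## References
* [Marcus2018] D. A. Marcus, *Number Fields*, 2nd ed. (2018), Ch. 3, Thm. 22 (norm is multiplicative, `N(𝔭) = p^f`)
  and Thm. 27.
-/

noncomputable section

open NumberField Ideal
open scoped NumberField

namespace Literature.NumberTheory.NumberFields

variable {K : Type*} [Field K] [NumberField K]

/-! ### Certified equality and factorisation of ideals from norms -/

/-- Two ideals `0 ≠ I ≤ J` of `𝓞 K` with equal norm are equal (the concrete-field copies in the tree,
`CyclicCubic1339A/B.eq_of_le_of_absNorm_eq`, are tied to those fields). [cite: Marcus2018, Ch. 3, Thm. 22] -/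
theorem eq_of_le_of_absNorm_eq' {I J : Ideal (𝓞 K)} (hle : I ≤ J) (hN : absNorm I = absNorm J)
    (hI : I ≠ ⊥) : I = J := by
  have h0 : absNorm I ≠ 0 := by rwa [Ne, Ideal.absNorm_eq_zero_iff]
  obtain ⟨L, hL⟩ := Ideal.dvd_iff_le.mpr hle
  have hmul : absNorm I = absNorm J * absNorm L := by rw [hL, map_mul]
  rw [hN] at hmul h0
  have hJ0 : absNorm J ≠ 0 := fun h => h0 (by rw [h])
  have hL1 : absNorm L = 1 := mul_left_cancel₀ hJ0 (hmul.symm.trans (mul_one _).symm)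
  rw [Ideal.absNorm_eq_one_iff] at hL1
  rw [hL, hL1, Ideal.mul_top]

omit [NumberField K] in
/-- Distinct maximal ideals are coprime. [cite: Marcus2018, Ch. 3, Thm. 22] -/
theorem isCoprime_of_isMaximal_ne {P Q : Ideal (𝓞 K)} (hP : P.IsMaximal) (hQ : Q.IsMaximal) (hne : P ≠ Q) :
    IsCoprime P Q :=
  Ideal.isCoprime_iff_sup_eq.mpr (hP.coprime_of_ne hQ hne)

omit [NumberField K] in
/-- A power of a maximal ideal is coprime to a different maximal ideal (and to its powers).
[cite: Marcus2018, Ch. 3, Thm. 22] -/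
theorem isCoprime_pow_of_isMaximal_ne {P Q : Ideal (𝓞 K)} (hP : P.IsMaximal) (hQ : Q.IsMaximal) (hne : P ≠ Q)
    (k l : ℕ) : IsCoprime (P ^ k) (Q ^ l) :=
  ((isCoprime_of_isMaximal_ne hP hQ hne).pow_left).pow_right

/-- **Certified factorisation into two coprime factors**: `I ≤ A`, `I ≤ B`, `A, B` coprime and
`N(I) = N(A) N(B)`, `I ≠ 0` give `I = A · B`. [cite: Marcus2018, Ch. 3, Thm. 22] -/
theorem eq_mul_of_le_of_le_of_isCoprime {I A B : Ideal (𝓞 K)} (hA : I ≤ A) (hB : I ≤ B) (hc : IsCoprime A B)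
    (hN : absNorm I = absNorm A * absNorm B) (hI : I ≠ ⊥) : I = A * B := by
  have hle : I ≤ A * B := by
    rw [Ideal.mul_eq_inf_of_isCoprime hc]
    exact le_inf hA hB
  exact eq_of_le_of_absNorm_eq' hle (by rw [hN, map_mul]) hI

/-- **Certified factorisation of a principal ideal**: `x ∈ A`, `x ∈ B`, `A, B` coprime, `|N(x)| = N(A) N(B) ≠ 0`
give `(x) = A · B`. [cite: Marcus2018, Ch. 3, Thm. 22] -/
theorem span_singleton_eq_mul_of_mem_of_mem {x : 𝓞 K} {A B : Ideal (𝓞 K)} (hA : x ∈ A) (hB : x ∈ B)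
    (hc : IsCoprime A B) (hN : (Algebra.norm ℤ x).natAbs = absNorm A * absNorm B) (hx : x ≠ 0) :
    span {x} = A * B := by
  refine eq_mul_of_le_of_le_of_isCoprime ((span_singleton_le_iff_mem _).mpr hA)
    ((span_singleton_le_iff_mem _).mpr hB) hc (by rw [absNorm_span_singleton, hN]) ?_
  rwa [Ne, span_singleton_eq_bot]

/-- Certified principal ideal: `x ∈ A` with `|N(x)| = N(A)`, `x ≠ 0`, gives `(x) = A`. [cite: Marcus2018, Ch. 3, Thm. 22] -/
theorem span_singleton_eq_of_mem_of_absNorm {x : 𝓞 K} {A : Ideal (𝓞 K)} (hA : x ∈ A)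
    (hN : (Algebra.norm ℤ x).natAbs = absNorm A) (hx : x ≠ 0) : span {x} = A := by
  refine eq_of_le_of_absNorm_eq' ((span_singleton_le_iff_mem _).mpr hA) (by rw [absNorm_span_singleton, hN]) ?_
  rwa [Ne, span_singleton_eq_bot]

/-! ### Kernels of maps to `ℤ/pᵏ` are `k`-th powers of degree-one primes -/

section ZModPow

variable {p : ℕ} [hp : Fact p.Prime] {k : ℕ}

omit [NumberField K] in
/-- **`𝔭ᵏ ⊆ ker ψ`** for `ψ : 𝓞 K → ℤ/pᵏ` and `𝔭 = ker (ψ mod p)`: the image of `𝔭` lies in `p ℤ/pᵏ`, whose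
`k`-th power vanishes. [cite: Marcus2018, Ch. 3, Thm. 27] -/
theorem pow_ker_le_ker_zmodPow (ψ : 𝓞 K →+* ZMod (p ^ k)) (hk : 1 ≤ k) :
    RingHom.ker ((ZMod.castHom (dvd_pow_self p (by omega)) (ZMod p)).comp ψ) ^ k ≤ RingHom.ker ψ := by
  set P := RingHom.ker ((ZMod.castHom (dvd_pow_self p (by omega)) (ZMod p)).comp ψ) with hP
  -- `ψ(P) ⊆ (p)`
  have hmap : Ideal.map ψ P ≤ span {(p : ZMod (p ^ k))} := by
    rw [Ideal.map_le_iff_le_comap]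
    intro x hx
    rw [hP, RingHom.mem_ker] at hx
    rw [Ideal.mem_comap, Ideal.mem_span_singleton]
    change ZMod.castHom (dvd_pow_self p (by omega)) (ZMod p) (ψ x) = 0 at hx
    rw [ZMod.castHom_apply] at hx
    obtain ⟨n, hn⟩ := ZMod.natCast_zmod_surjective (ψ x)
    rw [← hn, ZMod.cast_natCast (dvd_pow_self p (by omega)), ZMod.natCast_eq_zero_iff] at hx
    rw [← hn]
    obtain ⟨m, rfl⟩ := hx
    exact ⟨(m : ZMod (p ^ k)), by push_cast; ring⟩
  -- hence `ψ(P^k) ⊆ (p^k) = 0`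
  rw [RingHom.ker_eq_comap_bot, ← Ideal.map_le_iff_le_comap, Ideal.map_pow]
  calc (Ideal.map ψ P) ^ k ≤ span {(p : ZMod (p ^ k))} ^ k := Ideal.pow_right_mono hmap k
    _ = ⊥ := by
        rw [Ideal.span_singleton_pow, Ideal.span_singleton_eq_bot]
        exact_mod_cast ZMod.natCast_self (p ^ k)

omit hp in
/-- `N(ker ψ) = pᵏ` for `ψ : 𝓞 K → ℤ/pᵏ` (`ψ` is onto). [cite: Marcus2018, Ch. 3, Thm. 22] -/
theorem absNorm_ker_zmodPow (ψ : 𝓞 K →+* ZMod (p ^ k)) : absNorm (RingHom.ker ψ) = p ^ k := by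
  have e := RingHom.quotientKerEquivOfSurjective (ZMod.ringHom_surjective ψ)
  rw [Ideal.absNorm_apply, Submodule.cardQuot_apply, Nat.card_congr e.toEquiv, Nat.card_zmod]

/-- **`ker ψ = 𝔭ᵏ`**: for a ring homomorphism `ψ : 𝓞 K → ℤ/pᵏ` (`k ≥ 1`), the kernel is the `k`-th power of the
degree-one prime `𝔭 = ker (ψ mod p)` (`𝔭ᵏ ⊆ ker ψ` and both have norm `pᵏ`). [cite: Marcus2018, Ch. 3, Thm. 27] -/
theorem ker_zmodPow_eq_pow (ψ : 𝓞 K →+* ZMod (p ^ k)) (hk : 1 ≤ k) :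
    RingHom.ker ψ = RingHom.ker ((ZMod.castHom (dvd_pow_self p (by omega)) (ZMod p)).comp ψ) ^ k := by
  refine (eq_of_le_of_absNorm_eq' (pow_ker_le_ker_zmodPow ψ hk) ?_ ?_)
    |>.symm
  · rw [map_pow, absNorm_ker_zmod, absNorm_ker_zmodPow]
  · exact pow_ne_zero _ (ker_zmod_ne_bot _)

/-- **Membership in `𝔭ᵏ` is a congruence modulo `pᵏ`**: `x ∈ 𝔭ᵏ ⟺ ψ(x) = 0` for `ψ : 𝓞 K → ℤ/pᵏ` with
`𝔭 = ker (ψ mod p)`. [cite: Marcus2018, Ch. 3, Thm. 27] -/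
theorem mem_pow_iff_zmodPow_eq_zero (ψ : 𝓞 K →+* ZMod (p ^ k)) (hk : 1 ≤ k) (x : 𝓞 K) :
    x ∈ RingHom.ker ((ZMod.castHom (dvd_pow_self p (by omega)) (ZMod p)).comp ψ) ^ k ↔ ψ x = 0 := by
  rw [← ker_zmodPow_eq_pow ψ hk, RingHom.mem_ker]

/-- The prime under `ψ : 𝓞 K → ℤ/pᵏ` is determined by the value of `ψ mod p` on a generator: if
`φ : 𝓞 K → ℤ/p` agrees with `ψ mod p` then `ker ψ = (ker φ)ᵏ`. [cite: Marcus2018, Ch. 3, Thm. 27] -/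
theorem ker_zmodPow_eq_pow_of_comp_eq (ψ : 𝓞 K →+* ZMod (p ^ k)) (hk : 1 ≤ k) (φ : 𝓞 K →+* ZMod p)
    (h : (ZMod.castHom (dvd_pow_self p (by omega)) (ZMod p)).comp ψ = φ) :
    RingHom.ker ψ = RingHom.ker φ ^ k := by
  rw [ker_zmodPow_eq_pow ψ hk, h]

end ZModPow

end Literature.NumberTheory.NumberFields

end
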